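import Mathlib
import Summits.KontsevichZagierPeriods.Zeta5Search.BigPrimeWindow
import Summits.KontsevichZagierPeriods.Zeta5Search.BigPrimeNineResidual
import HarnessLib

/-!
# ζ(5) search — the k = 7 window law (W∞) AT THE CRITICAL PRIME `p = 5`: `max(5, b₀+1−b₍₂₎−b₍₃₎) ≤ p ≤ d(b)+1 ⟹ p ∣ W(b)`

Cell `pub-zeta5` (HONEST FRAMING: systematic search; no irrationality claim unless certified), family-designer seat
fam-vwp generation 13 (`planner-pub-zeta5-fam-vwp-g13-0`).  OUR theorem (Summit side; coefficient arithmetic only).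

The tree's level-2 window theorem for the Brown–Zudilin box (`BigPrimeWindow.one_le_padicValRat_coeffW_of_slots`,
k = 7) carries the hypothesis `7 ≤ p`, because the ζ(3)-coefficient `W(b)` is read off the power sum
`Σ_{x ∈ 𝔽_p} [X^5] M2(X + x)` and the Lucas count `BigPrime.sum_taylor_coeff_eq_zero` needs the read index `5 < p`.
At the CRITICAL prime `p = 5` (read index `= p`) the count is replaced by the second-order vanishing count of the
k = 9 file `BigPrimeNineResidual` (imported for its three generic lemmas `X_pow_card_sub_X_sq_dvd`,
`taylor_coeff_card_of_sq_mul`, `sum_taylor_coeff_card_eq_zero`): `M2` vanishes to order `≥ 2` at EVERY point of `𝔽_p`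
(order `6` off the image of the support block, `X_pow_six_dvd_taylor_M2`; order `2` at a pole, where both rim
complements vanish because the rims miss the pole modulo `p` for `p ≥ b₀+1−b_{j₂}−b_{j₃}`), so `(X^p − X)² ∣ M2 = W²·N`,
`[X^p] M2(X + x) = [X^{p−2}] N(X + x)`, and the count runs on `N` at index `p − 2`; it needs `deg M2 < p² + p − 1 = 29`,
and `natDegree_M2_le` with the window `p ≤ d(b)+1` gives `deg M2 ≤ 8p + 2Σb_j − 6b₀ − 5 ≤ 27`.

**THEOREM (`one_le_padicValRat_coeffW_of_slots'`).**  `b ∈ ℤ⁸` in the Brown–Zudilin polytope (`InBox`, `2b_j ≤ b₀`,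
`Σ b_j ≤ 3b₀`), slots `j₁`, `j₂ ≠ j₁`, `j₃` with `b_{j₂} ≤ b_{j₃} ≤ b_j` (`j ∉ {j₁, j₂}`), `p` prime, `5 ≤ p`,
`b₀ + 1 ≤ p + b_{j₂} + b_{j₃}`, `p ≤ d(b) + 1`, `W(b) ≠ 0` ⟹ `v_p(W(b)) ≥ 1`.  So the k = 7 window law holds for every
prime `max(5, b₀+1−b_{j₂}−b_{j₃}) ≤ p ≤ d(b)+1`; the threshold `5` is sharp (EXACT: (W)₇ fails at `p = 3` in 230 of
386 admissible slot multisets with `b₀ ≤ 40`), and at `p = 5` the law was OBSERVED-EXACT before this file on all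
4,192 + 33 admissible slot multisets with `b₀ ≤ 60` (0 failures; `g13/k7_p5_scan.py`).  The companion (U∞) law at its
critical prime `p = 3` is NOT treated (`BigPrimeDual2.z2_cast` is stated for `5 ≤ p`; 87 instances, 0 failures, b₀ ≤ 60).
-/

noncomputable section

open Finset Polynomial

namespace Summit.KontsevichZagierPeriods.Zeta5Search.BigPrime

open Summit.KontsevichZagierPeriods.Zeta5Search.DualSeries (InBox numPoly)
open Summit.KontsevichZagierPeriods.Zeta5Search.WedgeDictionary (IsPFData coeffW coeffW_eq exists_isPFData dOf)
open Summit.KontsevichZagierPeriods.Zeta5Search.BigPrimeNine (X_pow_card_sub_X_sq_dvd sum_taylor_coeff_card_eq_zero)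

/-! ### 1. `M2` (k = 7) vanishes to second order at every point of `𝔽_p` -/

section Vanishing

variable {p : ℕ} [hp : Fact p.Prime]

/-- `X² ∣ M2(X + x)` for EVERY `x ∈ 𝔽_p` (k = 7): order `6` off the image of the support block
(`X_pow_six_dvd_taylor_M2`); at a support point `−q` each rim complement contributes one factor `X`
(the rims miss `q` modulo `p` because `b₀ + 1 ≤ p + b_{j₂} + b_{j₃}`). -/
theorem X_sq_dvd_taylor_M2' {n : ℕ} {β : ℕ → ℕ} {j₁ j₂ j₃ : ℕ} (hj₁ : j₁ ∈ range 7)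
    (hj₂ : j₂ ∈ (range 7).erase j₁) (hT : n + 1 ≤ p + β j₂ + β j₃) (h23 : β j₂ ≤ β j₃) (h3 : 2 * β j₃ ≤ n)
    (hmin : ∀ j ∈ ((range 7).erase j₁).erase j₂, β j₃ ≤ β j) (x : ZMod p) :
    (X : (ZMod p)[X]) ^ 2 ∣ taylor x (M2 p n β j₁ j₂ j₃) := by
  by_cases hx : x ∈ (block n (β j₃)).image fun q : ℕ => -((q : ℕ) : ZMod p)
  · obtain ⟨q, hq, hqx⟩ := mem_image.1 hx
    have hq' := hq
    rw [block, mem_Icc] at hq'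
    set r : ZMod p := -((q : ℕ) : ZMod p) with hr
    have hXL : (X : (ZMod p)[X]) ∣ taylor r (KC p (rimL (β j₂) (β j₃))) := by
      have hmem : -r ∈ univ \ (rimL (β j₂) (β j₃)).image (Nat.cast : ℕ → ZMod p) := by
        rw [mem_sdiff]; refine ⟨mem_univ _, fun h => ?_⟩
        obtain ⟨s, hs, hsq⟩ := mem_image.1 h
        rw [rimL, mem_Ico] at hs
        rw [hr, neg_neg] at hsq
        have hm := (ZMod.natCast_eq_natCast_iff s q p).1 hsq
        have := hm.eq_of_abs_lt (by rw [abs_lt]; constructor <;> omega)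
        omega
      rw [KC, taylor_prod']
      have hfac : taylor r (X + C (-r)) = X := by rw [taylor_X_add_C, neg_add_cancel, C_0, add_zero]
      exact (dvd_of_eq hfac.symm).trans (Finset.dvd_prod_of_mem (fun u : ZMod p => taylor r (X + C u)) hmem)
    have hXR : (X : (ZMod p)[X]) ∣ taylor r (KC p (rimR n (β j₂) (β j₃))) := by
      have hmem : -r ∈ univ \ (rimR n (β j₂) (β j₃)).image (Nat.cast : ℕ → ZMod p) := by
        rw [mem_sdiff]; refine ⟨mem_univ _, fun h => ?_⟩
        obtain ⟨s, hs, hsq⟩ := mem_image.1 h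
        rw [rimR, mem_Ioc] at hs
        rw [hr, neg_neg] at hsq
        have hm := (ZMod.natCast_eq_natCast_iff s q p).1 hsq
        have := hm.eq_of_abs_lt (by rw [abs_lt]; constructor <;> omega)
        omega
      rw [KC, taylor_prod']
      have hfac : taylor r (X + C (-r)) = X := by rw [taylor_X_add_C, neg_add_cancel, C_0, add_zero]
      exact (dvd_of_eq hfac.symm).trans (Finset.dvd_prod_of_mem (fun u : ZMod p => taylor r (X + C u)) hmem)
    rw [← hqx, M2, taylor_mul, taylor_mul, taylor_mul, taylor_mul, taylor_mul, pow_two]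
    exact ((mul_dvd_mul hXL hXR).mul_left _).mul_left _
  · exact (pow_dvd_pow X (by norm_num : 2 ≤ 6)).trans (X_pow_six_dvd_taylor_M2 hj₁ hj₂ hmin x hx)

/-- Hence `(X^p − X)² ∣ M2` (k = 7). -/
theorem X_pow_card_sub_X_sq_dvd_M2' {n : ℕ} {β : ℕ → ℕ} {j₁ j₂ j₃ : ℕ} (hj₁ : j₁ ∈ range 7)
    (hj₂ : j₂ ∈ (range 7).erase j₁) (hT : n + 1 ≤ p + β j₂ + β j₃) (h23 : β j₂ ≤ β j₃) (h3 : 2 * β j₃ ≤ n)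
    (hmin : ∀ j ∈ ((range 7).erase j₁).erase j₂, β j₃ ≤ β j) :
    ((X : (ZMod p)[X]) ^ p - X) ^ 2 ∣ M2 p n β j₁ j₂ j₃ :=
  X_pow_card_sub_X_sq_dvd _ fun x => X_sq_dvd_taylor_M2' hj₁ hj₂ hT h23 h3 hmin x

end Vanishing

/-! ### 2. (W∞) on the window for every `p ≥ 5` -/

/-- (W∞) at level 2, cleared form, for ALL `p ≥ 5` (`b₀ + 1 ≤ p + b_{j₂} + b_{j₃}`, `p ≤ d(b) + 1`): `p ≥ 7` is the
tree's `exists_clear_coeffW_of_slots`; at `p = 5` the power sum is read at the critical index `5 = p`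
(`BigPrimeNine.sum_taylor_coeff_card_eq_zero`, `deg M2 ≤ 27 < 29`). -/
theorem exists_clear_coeffW_of_slots' (b : ℕ → ℤ) (p j₁ j₂ j₃ : ℕ) (hb : InBox b)
    (h2 : ∀ i ∈ range 7, 2 * b (i + 1) ≤ b 0) (h3 : ∑ i ∈ range 7, b (i + 1) ≤ 3 * b 0)
    (hj₁ : j₁ ∈ range 7) (hj₂ : j₂ ∈ range 7) (hj₃ : j₃ ∈ range 7) (h12 : j₂ ≠ j₁)
    (hle : b (j₂ + 1) ≤ b (j₃ + 1)) (hmin : ∀ j ∈ range 7, j ≠ j₁ → j ≠ j₂ → b (j₃ + 1) ≤ b (j + 1))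
    (hprime : p.Prime) (hp5 : 5 ≤ p) (hpT : b 0 + 1 ≤ (p : ℤ) + b (j₂ + 1) + b (j₃ + 1))
    (hpd : (p : ℤ) ≤ dOf b + 1) :
    ∃ U Z : ℤ, ¬ (p : ℤ) ∣ U ∧ (p : ℤ) ∣ Z ∧ (U : ℚ) * coeffW b = Z := by
  by_cases hp7 : 7 ≤ p
  · exact exists_clear_coeffW_of_slots b p j₁ j₂ j₃ hb h2 h3 hj₁ hj₂ hj₃ h12 hle hmin hprime hp7 hpT hpd
  have hlt : p < 7 := by omega
  obtain rfl : p = 5 := by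
    interval_cases p
    · rfl
    all_goals exact absurd hprime (by decide)
  haveI : Fact (Nat.Prime 5) := ⟨hprime⟩
  obtain ⟨e0, hS, hβ, hS3⟩ := polytope_data b hb h2 h3
  have hj₂' : j₂ ∈ (range 7).erase j₁ := mem_erase.2 ⟨h12, hj₂⟩
  have h02 : 0 ≤ b (j₂ + 1) := (hb.2 j₂ hj₂).1
  have h03 : 0 ≤ b (j₃ + 1) := (hb.2 j₃ hj₃).1
  have e2 : (b (j₂ + 1) : ℤ) = ((b (j₂ + 1)).toNat : ℤ) := (Int.toNat_of_nonneg h02).symm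
  have e3 : (b (j₃ + 1) : ℤ) = ((b (j₃ + 1)).toNat : ℤ) := (Int.toNat_of_nonneg h03).symm
  have h23 : (b (j₂ + 1)).toNat ≤ (b (j₃ + 1)).toNat := Int.toNat_le_toNat hle
  have hmin' : ∀ j ∈ ((range 7).erase j₁).erase j₂, (b (j₃ + 1)).toNat ≤ (b (j + 1)).toNat := by
    intro j hj
    have hj' := mem_erase.1 hj; have hj'' := mem_erase.1 hj'.2
    exact Int.toNat_le_toNat (hmin j hj''.2 hj''.1 hj'.1)
  have hT' : (b 0).toNat + 1 ≤ 5 + (b (j₂ + 1)).toNat + (b (j₃ + 1)).toNat := by omega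
  have hS' : (b 0).toNat + 1 ≤ 5 + 2 * (b (j₃ + 1)).toNat := by omega
  have h3' : 2 * (b (j₃ + 1)).toNat ≤ (b 0).toNat := hβ j₃ hj₃
  have hpd' : 5 + ∑ j ∈ range 7, (b (j + 1)).toNat ≤ 3 * (b 0).toNat + 1 := by
    have := hpd; rw [dOf, hS, e0] at this; omega
  have hhalf : ∀ j ∈ range 7, 2 * b (j + 1) ≤ b 0 + 1 := fun j hj => by have := h2 j hj; omega
  obtain ⟨c, hc⟩ := exists_isPFData b hb (by omega)
  refine ⟨_, _, not_dvd_U2all hprime hT' h23, ?_,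
    by rw [coeffW_eq hc]; exact U2all_mul_sum_eq b hb hhalf hc hj₁ hj₂' h23 hmin' (by norm_num) (by norm_num : 2 < 6)⟩
  rw [← ZMod.intCast_zmod_eq_zero_iff_dvd, Z2sum_cast (le_refl 5) hj₁ hj₂' hS' hT' h23 h3' hmin' (by norm_num : 3 < 4),
    sum_taylor_coeff_card_eq_zero (M2 5 (b 0).toNat (fun j => (b (j + 1)).toNat) j₁ j₂ j₃)
      (X_pow_card_sub_X_sq_dvd_M2' hj₁ hj₂' hT' h23 h3' hmin') ?_, mul_zero]
  have := natDegree_M2_le (p := 5) hj₁ hj₂' hS' hT' h23 hmin' hβ h3'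
  beta_reduce at this
  omega

/-- **(W∞) ON THE FULL WINDOW, CRITICAL PRIME INCLUDED.**  Let `b` lie in the Brown–Zudilin polytope; drop a slot `j₁`,
let `j₂ ≠ j₁` be a slot with `b_{j₂} ≤ b_{j₃}` and `j₃` a slot with `b_{j₃} ≤ b_j` for every other slot `j ∉ {j₁, j₂}`.
Then EVERY prime `p ≥ 5` with `b₀ + 1 − b_{j₂} − b_{j₃} ≤ p ≤ d(b) + 1` divides the ζ(3)-coefficient: `v_p(W(b)) ≥ 1`
(if `W(b) ≠ 0`) — the tree's `one_le_padicValRat_coeffW_of_slots` (`p ≥ 7`) plus the critical prime `p = 5`. -/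
theorem one_le_padicValRat_coeffW_of_slots' (b : ℕ → ℤ) (p j₁ j₂ j₃ : ℕ) (hb : InBox b)
    (h2 : ∀ i ∈ range 7, 2 * b (i + 1) ≤ b 0) (h3 : ∑ i ∈ range 7, b (i + 1) ≤ 3 * b 0)
    (hj₁ : j₁ ∈ range 7) (hj₂ : j₂ ∈ range 7) (hj₃ : j₃ ∈ range 7) (h12 : j₂ ≠ j₁)
    (hle : b (j₂ + 1) ≤ b (j₃ + 1)) (hmin : ∀ j ∈ range 7, j ≠ j₁ → j ≠ j₂ → b (j₃ + 1) ≤ b (j + 1))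
    (hprime : p.Prime) (hp5 : 5 ≤ p) (hpT : b 0 + 1 ≤ (p : ℤ) + b (j₂ + 1) + b (j₃ + 1))
    (hpd : (p : ℤ) ≤ dOf b + 1) (hW : coeffW b ≠ 0) : 1 ≤ padicValRat p (coeffW b) := by
  haveI : Fact p.Prime := ⟨hprime⟩
  obtain ⟨U, Z, hU, hZ, hUW⟩ :=
    exists_clear_coeffW_of_slots' b p j₁ j₂ j₃ hb h2 h3 hj₁ hj₂ hj₃ h12 hle hmin hprime hp5 hpT hpd
  exact one_le_padicValRat_of_eq hUW hU hZ hW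

/-- The degree budget at the critical prime: `p² + p − 1 = 29` at `p = 5`, against `deg M2 ≤ 27`. -/
example : 2 * 5 + ((5 - 2) + (5 - 2 + 1) * (5 - 1)) = 29 := by norm_num

end Summit.KontsevichZagierPeriods.Zeta5Search.BigPrime

end
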